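import Literature.Analysis.ValidatedNumerics.TaylorModelIntegralCertElem
import HarnessLib

/-!
# Kernel-checkable integral certificates for straight-line programs (shared sub-expressions)

Trunk T-ANA (Analysis/ValidatedNumerics); namespace `Literature.Analysis.ValidatedNumerics.PolyMP`.
Sequel of `TaylorModelIntegralCertElem.lean`.  There the integrand is an expression TREE (`EExpr`), so a common
sub-expression is re-modelled at every occurrence (`K⁴ = (K·K)·(K·K)` models `K` four times per panel).  Here
the integrand is a **straight-line program** in the sense of Melquiond (the representation used by the Coq
`interval` tactic): a list of statements, each an operation of the `EExpr` grammar whose operands are the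
results of EARLIER statements, addressed by their RELATIVE position on the evaluation stack (`0` = the most
recent result); accessing past the bottom of the stack yields a default value.  The denoted function and its
panel Taylor model are both computed by ONE generic pass over the program, so every shared sub-expression is
modelled once; the Taylor-model arithmetic per statement is literally that of `EExpr.model`, hence a program and
the tree it unfolds to produce bit-identical enclosures.

* `SOp` (statements), `SProg = List SOp`, `getReg` (stack access with default), `SOp.evalF`, `SProg.runF`,
  `SProg.toFun` (the real function: top of the final stack, run on the empty stack);
* `StackMem S h c fs Ws` (every register function `u ↦ fs[i](c+u)` is enclosed by the register model `Ws[i]`),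
  `SOp.model`, `SOp.tmem_model`, `SProg.model`, `SProg.stackMem_model`, `SProg.pmodel`, `SProg.tmem_pmodel`,
  `SProg.measurable_toFun`;
* the certificate `certDataS`, `certCheckS`, **`integral_bounds_of_certCheckS`**:
  `certCheckS … = true → lo ≤ ∫₀^{2nh} P(t) q(t) dt ≤ hi` — no side hypotheses;
* the SHARDED form over an arbitrary integrand function: `FSegOK f q S a b lo hi` (so that segments certified from
  different presentations of the same function glue), `fsegOK_of_tmem`, `panelCheckS`, `fsegOK_of_panelCheckS`,
  `FSegOK.append`, `FSegOK.bounds` (the `EExpr` segments `SegOK E …` of the previous file are the special case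
  `FSegOK E.toFun …`, by `Iff.rfl`).

Parameters as before (`S`, `D`, `K`, `Ke`, `ke`, `Kl`); reciprocal / square-root statements consume one thin
candidate each, in program order.  Problem-independent; no facts, no axioms.

## References

* G. Melquiond, *Proving bounds on real-valued functions with computations*, IJCAR 2008, LNCS 5195, 2–17:
  Sect. 3.3 "Straight-line programs" (expressions as straight-line programs with stack-relative operands, one
  generic evaluator instantiated at reals / intervals / …, default value past the stack bottom).
  [cite: Melquiond2008, Sect. 3.3]
* M. Joldeş, *Rigorous Polynomial Approximations and Applications*, PhD thesis, ENS Lyon (2011), Algorithm 2.2.10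
  (Taylor models of expressions by structural recursion) and Algorithm 2.2.8 (composition with the intrinsics).
  [cite: Joldes2011, Algorithm 2.2.10]
* A. Mahboubi, G. Melquiond, T. Sibut-Pinote, *Formally verified approximations of definite integrals*, ITP 2016,
  LNCS 9807, 274–289: Sect. 3.2 Lemma 3 (polynomial integral enclosure per panel), Sect. 3.3 (summing over a
  decomposition of the domain). [cite: MahboubiMelquiondSibutpinote2016, Sect. 3.2 Lemma 3]
-/

open MeasureTheory intervalIntegral Set

namespace Literature.Analysis.ValidatedNumerics

namespace PolyMP

open Literature.Analysis.ValidatedNumerics.NumericsMP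
open Literature.Analysis.ValidatedNumerics.ExpPoly (Poly BPoly)
open Literature.Analysis.ValidatedNumerics.ExpPoly

/-- [folklore] -/
private theorem eval_recenterAt'' (g : Poly) (c : ℚ) (u : ℝ) :
    Poly.eval (recenterAt g c) u = Poly.eval g ((c : ℝ) + u) := by
  rw [recenterAt, BPoly.eval_subst, BPoly.eval_taylor]
  simp [Poly.eval, add_comm]

/-- [folklore] -/
private theorem mem_expQ'' {S : ℕ} (hS : 0 < S) {Ke ke : ℕ} {x : ℚ}
    (h : (MI.expPt S Ke ke (ofRat S x)).isSome = true) : MI.mem S (Real.exp x) (expQ S Ke ke x) := by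
  obtain ⟨Y, hY⟩ := Option.isSome_iff_exists.1 h
  rw [expQ, hY, Option.getD_some]
  exact MI.mem_expPt hS hY (mem_ofRat S x)

/-! ### Straight-line programs and their semantics -/

/-- Access to the evaluation stack by relative position (`0` = most recent), with a default value past the
bottom of the stack. [cite: Melquiond2008, Sect. 3.3] -/
def getReg {α : Type} (d : α) : List α → ℕ → α
  | [], _ => d
  | a :: _, 0 => a
  | _ :: l, i + 1 => getReg d l i

/-- Past the bottom of the stack: the default value. [cite: Melquiond2008, Sect. 3.3] -/
@[simp] theorem getReg_nil {α : Type} (d : α) (i : ℕ) : getReg d [] i = d := by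
  cases i <;> rfl

/-- Relative position `0` is the most recent result. [cite: Melquiond2008, Sect. 3.3] -/
@[simp] theorem getReg_cons_zero {α : Type} (d a : α) (l : List α) : getReg d (a :: l) 0 = a := rfl

/-- Relative position `i+1` is position `i` below the most recent result. [cite: Melquiond2008, Sect. 3.3] -/
@[simp] theorem getReg_cons_succ {α : Type} (d a : α) (l : List α) (i : ℕ) :
    getReg d (a :: l) (i + 1) = getReg d l i := rfl

/-- The statements of a straight-line program: the operations of the grammar `EExpr`, the operands of the
arithmetic / intrinsic statements being stack-relative positions of earlier results.
[cite: Melquiond2008, Sect. 3.3] -/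
inductive SOp : Type
  /-- push the exact rational polynomial `g(t)` -/
  | poly (g : Poly) : SOp
  /-- push `e^{a + b t}` -/
  | expAff (a b : ℚ) : SOp
  /-- push `−vᵢ` -/
  | neg (i : ℕ) : SOp
  /-- push `vᵢ + vⱼ` -/
  | add (i j : ℕ) : SOp
  /-- push `vᵢ · vⱼ` -/
  | mul (i j : ℕ) : SOp
  /-- push `1 / vᵢ` (a certificate statement: consumes one thin candidate per panel) -/
  | inv (i : ℕ) : SOp
  /-- push `√vᵢ` (a certificate statement: consumes one thin candidate per panel) -/
  | sqrt (i : ℕ) : SOp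
  /-- push `log vᵢ` (accepted only where `vᵢ > 0` is certified) -/
  | log (i : ℕ) : SOp
  /-- push `e^{vᵢ}` -/
  | exp (i : ℕ) : SOp
  deriving Inhabited

/-- A straight-line program: its statements in execution order. [cite: Melquiond2008, Sect. 3.3] -/
abbrev SProg : Type := List SOp

namespace SOp

/-- The real function pushed by one statement, given the stack `fs` of the functions computed so far (the generic
evaluator of op. cit. instantiated at `A = ℝ → ℝ`, default `0`). [cite: Melquiond2008, Sect. 3.3] -/
noncomputable def evalF (fs : List (ℝ → ℝ)) : SOp → ℝ → ℝ
  | poly g => fun t => Poly.eval g t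
  | expAff a b => fun t => Real.exp ((a : ℝ) + b * t)
  | neg i => fun t => -getReg (fun _ => (0 : ℝ)) fs i t
  | add i j => fun t => getReg (fun _ => (0 : ℝ)) fs i t + getReg (fun _ => (0 : ℝ)) fs j t
  | mul i j => fun t => getReg (fun _ => (0 : ℝ)) fs i t * getReg (fun _ => (0 : ℝ)) fs j t
  | inv i => fun t => (getReg (fun _ => (0 : ℝ)) fs i t)⁻¹
  | sqrt i => fun t => Real.sqrt (getReg (fun _ => (0 : ℝ)) fs i t)
  | log i => fun t => Real.log (getReg (fun _ => (0 : ℝ)) fs i t)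
  | exp i => fun t => Real.exp (getReg (fun _ => (0 : ℝ)) fs i t)

end SOp

namespace SProg

/-- Run a program on a stack of functions: each statement pushes its result. [cite: Melquiond2008, Sect. 3.3] -/
noncomputable def runF : SProg → List (ℝ → ℝ) → List (ℝ → ℝ)
  | [], fs => fs
  | op :: p, fs => runF p (op.evalF fs :: fs)

/-- The real function denoted by a program: the last result of its run on the empty stack.
[cite: Melquiond2008, Sect. 3.3] -/
noncomputable def toFun (p : SProg) : ℝ → ℝ := getReg (fun _ => (0 : ℝ)) (p.runF []) 0

end SProg

/-! ### Measurability of the denoted function -/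

/-- [folklore] -/
private theorem measurable_evalF {fs : List (ℝ → ℝ)} (hfs : ∀ i, Measurable (getReg (fun _ => (0 : ℝ)) fs i)) :
    ∀ op : SOp, Measurable (op.evalF fs)
  | SOp.poly g => (Poly.continuous_eval g).measurable
  | SOp.expAff a b => by
      show Measurable fun t : ℝ => Real.exp ((a : ℝ) + b * t)
      exact Real.measurable_exp.comp (measurable_const.add (measurable_const.mul measurable_id))
  | SOp.neg i => (hfs i).neg
  | SOp.add i j => (hfs i).add (hfs j)
  | SOp.mul i j => (hfs i).mul (hfs j)
  | SOp.inv i => (hfs i).inv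
  | SOp.sqrt i => Real.continuous_sqrt.measurable.comp (hfs i)
  | SOp.log i => Real.measurable_log.comp (hfs i)
  | SOp.exp i => Real.measurable_exp.comp (hfs i)

/-- [folklore] -/
private theorem measurable_getReg_cons {f : ℝ → ℝ} {fs : List (ℝ → ℝ)} (hf : Measurable f)
    (hfs : ∀ i, Measurable (getReg (fun _ => (0 : ℝ)) fs i)) :
    ∀ i, Measurable (getReg (fun _ => (0 : ℝ)) (f :: fs) i)
  | 0 => by simpa using hf
  | i + 1 => by simpa using hfs i

/-- [folklore] -/
private theorem measurable_runF : ∀ (p : SProg) (fs : List (ℝ → ℝ)),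
    (∀ i, Measurable (getReg (fun _ => (0 : ℝ)) fs i)) →
      ∀ i, Measurable (getReg (fun _ => (0 : ℝ)) (p.runF fs) i)
  | [], fs, hfs => by simpa [SProg.runF] using hfs
  | op :: p, fs, hfs => by
      rw [SProg.runF]
      exact measurable_runF p _ (measurable_getReg_cons (measurable_evalF hfs op) hfs)

/-- The function denoted by a program is measurable (junk values of `⁻¹`, `√`, `log` included). [folklore] -/
private theorem SProg.measurable_toFun (p : SProg) : Measurable p.toFun := by
  unfold SProg.toFun
  exact measurable_runF p [] (fun i => by rw [getReg_nil]; exact measurable_const) 0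

/-! ### The panel Taylor model of a program -/

/-- **Stack invariant**: every register function, shifted to the panel centre `c`, is enclosed on `|u| ≤ h` by the
corresponding register model (positions past either stack bottom hold the defaults `0` and `[]`, which match).
[cite: Melquiond2008, Sect. 3.3] -/
def StackMem (S : ℕ) (h : ℚ) (c : ℚ) (fs : List (ℝ → ℝ)) (Ws : List IPoly) : Prop :=
  ∀ i : ℕ, TMem S h (fun u => getReg (fun _ => (0 : ℝ)) fs i ((c : ℝ) + u)) (getReg [] Ws i)

/-- [folklore] -/
private theorem stackMem_nil (S : ℕ) (h : ℚ) (c : ℚ) : StackMem S h c [] [] := fun i ρ _ =>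
  ⟨[], by rw [getReg_nil]; exact pmem_nil S, by simp⟩

/-- [folklore] -/
private theorem StackMem.cons {S : ℕ} {h : ℚ} {c : ℚ} {fs : List (ℝ → ℝ)} {Ws : List IPoly} (f : ℝ → ℝ) {W : IPoly}
    (hf : TMem S h (fun u => f ((c : ℝ) + u)) W) (hst : StackMem S h c fs Ws) :
    StackMem S h c (f :: fs) (W :: Ws) := fun i => by
  cases i with
  | zero => simpa using hf
  | succ i => simpa using hst i

namespace SOp

/-- **The Taylor model pushed by one statement** on the panel `|u| ≤ h` centred at `c`, given the stack `Ws` of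
register models; reciprocal / square-root statements consume one thin candidate from `cs`; the arithmetic is that
of `EExpr.model`, node for node (result record as for `WExpr.model`).
[cite: Joldes2011, Algorithm 2.2.10] -/
def model (S : ℕ) (h : ℚ) (D K Ke ke Kl : ℕ) (c : ℚ) (Ws : List IPoly) : SOp → List (List ℤ × ℕ) → WExpr.MRes
  | poly g, cs => ⟨ratPolyI S (recenterAt g c), cs, true⟩
  | expAff a b, cs => ⟨tsmulI S (expQ S Ke ke (a + b * c)) (texpI S h K b), cs,
      (MI.expPt S Ke ke (ofRat S (a + b * c))).isSome && decide (|b * h| ≤ 1) && decide (0 < K)⟩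
  | neg i, cs => ⟨tnegI (getReg [] Ws i), cs, true⟩
  | add i j, cs => ⟨taddI (getReg [] Ws i) (getReg [] Ws j), cs, true⟩
  | mul i j, cs => ⟨tmulI S h D (getReg [] Ws i) (getReg [] Ws j), cs, true⟩
  | inv _, [] => ⟨[], [], false⟩
  | inv i, d :: cs' => ⟨widen0 (thinI d.1) d.2, cs', checkInv S h D (getReg [] Ws i) (thinI d.1) d.2⟩
  | sqrt _, [] => ⟨[], [], false⟩
  | sqrt i, d :: cs' => ⟨widen0 (thinI d.1) d.2, cs', checkSqrt S h D (getReg [] Ws i) (thinI d.1) d.2⟩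
  | log i, cs =>
      let t := tlogTM S h D K Kl (getReg [] Ws i)
      ⟨t.1, cs, t.2⟩
  | exp i, cs =>
      let t := texpTM S h D K Ke ke (getReg [] Ws i)
      ⟨t.1, cs, t.2⟩

/-- **Soundness of `SOp.model`** under the stack invariant. [cite: Joldes2011, Algorithm 2.2.10] -/
theorem tmem_model {S : ℕ} (hS : 0 < S) {h : ℚ} (h0 : 0 ≤ h) {D K Ke ke Kl : ℕ} (c : ℚ)
    {fs : List (ℝ → ℝ)} {Ws : List IPoly} (hst : StackMem S h c fs Ws) :
    ∀ (op : SOp) (cs : List (List ℤ × ℕ)), (op.model S h D K Ke ke Kl c Ws cs).ok = true →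
      TMem S h (fun u => op.evalF fs ((c : ℝ) + u)) (op.model S h D K Ke ke Kl c Ws cs).P
  | poly g, cs, _ => by
      have hm := tmem_ratPoly S h (recenterAt g c)
      simp only [eval_recenterAt''] at hm
      exact hm
  | expAff a b, cs, hok => by
      simp only [model, Bool.and_eq_true, decide_eq_true_eq] at hok
      obtain ⟨⟨hsome, hbh⟩, hK⟩ := hok
      have hm := tmem_smulI hS (mem_expQ'' hS hsome) (tmem_exp (S := S) (h := h) hK hbh)
      intro ρ hρ
      obtain ⟨as, has, hev⟩ := hm ρ hρ
      refine ⟨as, has, ?_⟩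
      rw [← hev]
      show Real.exp ((a : ℝ) + b * ((c : ℝ) + ρ)) = _
      push_cast
      rw [← Real.exp_add]
      congr 1
      ring
  | neg i, cs, _ => by
      simp only [model]
      exact tmem_neg (hst i)
  | add i j, cs, _ => by
      simp only [model]
      exact tmem_add (hst i) (hst j)
  | mul i j, cs, _ => by
      simp only [model]
      exact tmem_mul hS h0 D (hst i) (hst j)
  | inv i, [], hok => by simp [model] at hok
  | inv i, d :: cs', hok => by
      simp only [model] at hok ⊢
      exact tmem_inv_of_check hS h0 (hst i) (tmem_thin hS h d.1) hok
  | sqrt i, [], hok => by simp [model] at hok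
  | sqrt i, d :: cs', hok => by
      simp only [model] at hok ⊢
      exact tmem_sqrt_of_check hS h0 (hst i) (tmem_thin hS h d.1) hok
  | log i, cs, hok => by
      simp only [model] at hok ⊢
      exact tmem_log_of_tlogTM hS h0 (hst i) hok
  | exp i, cs, hok => by
      simp only [model] at hok ⊢
      exact tmem_exp_of_texpTM hS h0 (hst i) hok

end SOp

namespace SProg

/-- **The register models after running a program** on the panel centred at `c` from the stack `Ws`, with the
conjunctive acceptance flag (candidates consumed in program order). [cite: Melquiond2008, Sect. 3.3] -/
def model (S : ℕ) (h : ℚ) (D K Ke ke Kl : ℕ) (c : ℚ) : SProg → List IPoly → List (List ℤ × ℕ) → List IPoly × Bool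
  | [], Ws, _ => (Ws, true)
  | op :: p, Ws, cs =>
      let r := op.model S h D K Ke ke Kl c Ws cs
      let s := model S h D K Ke ke Kl c p (r.P :: Ws) r.rest
      (s.1, r.ok && s.2)

/-- **Soundness of `SProg.model`**: the stack invariant is preserved by an accepted run.
[cite: Melquiond2008, Sect. 3.3] -/
theorem stackMem_model {S : ℕ} (hS : 0 < S) {h : ℚ} (h0 : 0 ≤ h) {D K Ke ke Kl : ℕ} (c : ℚ) :
    ∀ (p : SProg) {fs : List (ℝ → ℝ)} {Ws : List IPoly}, StackMem S h c fs Ws →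
      ∀ cs : List (List ℤ × ℕ), (p.model S h D K Ke ke Kl c Ws cs).2 = true →
        StackMem S h c (p.runF fs) (p.model S h D K Ke ke Kl c Ws cs).1
  | [], _, _, hst, cs, _ => by simpa [model, runF] using hst
  | op :: p, fs, Ws, hst, cs, hok => by
      simp only [model, Bool.and_eq_true] at hok
      rw [runF, model]
      exact stackMem_model hS h0 c p
        (hst.cons (op.evalF fs) (SOp.tmem_model hS h0 c hst op cs hok.1 (D := D) (K := K) (Ke := Ke)
          (ke := ke) (Kl := Kl))) _ hok.2

/-- **The panel Taylor model of `u ↦ P(c + u)`**: the top register model after the run on the empty stack, with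
its acceptance flag. [cite: Melquiond2008, Sect. 3.3] -/
def pmodel (S : ℕ) (h : ℚ) (D K Ke ke Kl : ℕ) (c : ℚ) (p : SProg) (cs : List (List ℤ × ℕ)) : IPoly × Bool :=
  let s := p.model S h D K Ke ke Kl c [] cs
  (getReg [] s.1 0, s.2)

/-- **Soundness of `pmodel`**: an accepted model encloses `u ↦ P(c + u)` on `|u| ≤ h`.
[cite: Joldes2011, Algorithm 2.2.10] -/
theorem tmem_pmodel {S : ℕ} (hS : 0 < S) {h : ℚ} (h0 : 0 ≤ h) {D K Ke ke Kl : ℕ} (c : ℚ) (p : SProg)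
    (cs : List (List ℤ × ℕ)) (hok : (p.pmodel S h D K Ke ke Kl c cs).2 = true) :
    TMem S h (fun u => p.toFun ((c : ℝ) + u)) (p.pmodel S h D K Ke ke Kl c cs).1 := by
  unfold pmodel at hok ⊢
  unfold toFun
  exact stackMem_model hS h0 c p (stackMem_nil S h c) cs hok 0

end SProg

/-! ### The certificate -/

/-- The panel data `(W_j, pw_j)` of panels `j₀, j₀+1, …` with its conjunctive acceptance flag; one candidate list per
panel. [folklore] -/
def certDataS (S : ℕ) (h : ℚ) (D K Ke ke Kl : ℕ) (p : SProg) :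
    List (List (List ℤ × ℕ)) → ℕ → List (IPoly × Poly) × Bool
  | [], _ => ([], true)
  | cs :: css, j =>
      let r := p.pmodel S h D K Ke ke Kl (panelCentre h j) cs
      let t := certDataS S h D K Ke ke Kl p css (j + 1)
      ((r.1, midPoly S r.1) :: t.1, r.2 && t.2)

/-- [folklore] -/
private theorem length_certDataS (S : ℕ) (h : ℚ) (D K Ke ke Kl : ℕ) (p : SProg) :
    ∀ (css : List (List (List ℤ × ℕ))) (j : ℕ), (certDataS S h D K Ke ke Kl p css j).1.length = css.length
  | [], _ => rfl
  | _ :: css, j => by simp [certDataS, length_certDataS S h D K Ke ke Kl p css (j + 1)]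

/-- [folklore] -/
private theorem tmem_certDataS {S : ℕ} (hS : 0 < S) {h : ℚ} (h0 : 0 ≤ h) {D K Ke ke Kl : ℕ} (p : SProg) :
    ∀ (css : List (List (List ℤ × ℕ))) (j₀ : ℕ), (certDataS S h D K Ke ke Kl p css j₀).2 = true →
      ∀ i : Fin (certDataS S h D K Ke ke Kl p css j₀).1.length,
        TMem S h (fun u => p.toFun ((panelCentre h (j₀ + (i : ℕ)) : ℝ) + u))
          ((certDataS S h D K Ke ke Kl p css j₀).1.get i).1
  | [], _, _, i => i.elim0
  | cs :: css, j₀, hok, ⟨0, _⟩ => by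
      simp only [certDataS, Bool.and_eq_true] at hok
      simpa [certDataS] using SProg.tmem_pmodel hS h0 (panelCentre h j₀) p cs hok.1
  | cs :: css, j₀, hok, ⟨i + 1, hi⟩ => by
      simp only [certDataS, Bool.and_eq_true] at hok
      have hi' : i < (certDataS S h D K Ke ke Kl p css (j₀ + 1)).1.length := by
        simpa [certDataS] using hi
      have ih := tmem_certDataS hS h0 p css (j₀ + 1) hok.2 ⟨i, hi'⟩
      have e : j₀ + 1 + i = j₀ + (i + 1) := by omega
      simpa [certDataS, e] using ih

/-- **The certificate** for `lo ≤ ∫₀^{2nh} P(t) q(t) dt ≤ hi` (`n = css.length`): positivity of `S` and `h`, every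
panel model accepted, and the kernel enclosure inside `[lo·S, hi·S]`. [folklore] -/
def certCheckS (S : ℕ) (h : ℚ) (D K Ke ke Kl : ℕ) (p : SProg) (q : Poly) (css : List (List (List ℤ × ℕ)))
    (lo hi : ℚ) : Bool :=
  let d := certDataS S h D K Ke ke Kl p css 0
  let I := fullPanelsI S h q d.1 0
  decide (0 < S) && decide (0 < h) && d.2 && decide (lo * S ≤ (I.lo : ℚ)) && decide ((I.hi : ℚ) ≤ hi * S)

/-- **Soundness of the certificate** (no side hypotheses): the piecewise polynomial integral enclosure re-computed
by the kernel from untrusted data, for integrands given as straight-line programs.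
[cite: MahboubiMelquiondSibutpinote2016, Sect. 3.2 Lemma 3, Sect. 4 (3)] -/
theorem integral_bounds_of_certCheckS {S : ℕ} {h : ℚ} {D K Ke ke Kl : ℕ} {p : SProg} {q : Poly}
    {css : List (List (List ℤ × ℕ))} {lo hi : ℚ} (hc : certCheckS S h D K Ke ke Kl p q css lo hi = true) :
    (lo : ℝ) ≤ ∫ t in (0 : ℝ)..(2 * css.length * (h : ℝ)), p.toFun t * Poly.eval q t ∧
      ∫ t in (0 : ℝ)..(2 * css.length * (h : ℝ)), p.toFun t * Poly.eval q t ≤ (hi : ℝ) := by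
  unfold certCheckS at hc
  simp only [Bool.and_eq_true, decide_eq_true_eq] at hc
  obtain ⟨⟨⟨⟨hS, h0⟩, hok⟩, hlo⟩, hhi⟩ := hc
  have hD := tmem_certDataS hS h0.le p css 0 hok (D := D) (K := K) (Ke := Ke) (ke := ke) (Kl := Kl)
  simp only [Nat.zero_add] at hD
  obtain ⟨hm, -⟩ := mem_fullPanelsI_of_tmem hS h0.le (SProg.measurable_toFun p) q
    (certDataS S h D K Ke ke Kl p css 0).1 0 (fun i => by simpa using hD i)
  rw [length_certDataS] at hm
  have e1 : (2 * ((0 : ℕ) : ℝ) * (h : ℝ)) = 0 := by simp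
  have e2 : (2 * (((0 : ℕ) : ℝ) + (css.length : ℕ)) * (h : ℝ)) = 2 * css.length * (h : ℝ) := by simp
  rw [e1, e2] at hm
  obtain ⟨h1, h2⟩ := hm
  have hSr : (0 : ℝ) < S := by exact_mod_cast hS
  have hloR : (lo : ℝ) * S ≤ ((fullPanelsI S h q (certDataS S h D K Ke ke Kl p css 0).1 0).lo : ℝ) := by
    exact_mod_cast hlo
  have hhiR : ((fullPanelsI S h q (certDataS S h D K Ke ke Kl p css 0).1 0).hi : ℝ) ≤ (hi : ℝ) * S := by
    exact_mod_cast hhi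
  exact ⟨le_of_mul_le_mul_right (hloR.trans h1) hSr, le_of_mul_le_mul_right (h2.trans hhiR) hSr⟩

/-! ### Sharded certificates over an arbitrary integrand function

One kernel check per panel, glued by additivity over adjacent intervals (op. cit., Sect. 3.3).  The segment
predicate is stated for an arbitrary `f : ℝ → ℝ`, so that segments of one function certified from different
presentations (a program here, an expression tree in `TaylorModelIntegralCertElem.lean`, several programs for
several sub-ranges) can be appended. -/

/-- **Segment predicate**: the scaled integral `S·∫_a^b f(t) q(t) dt` lies in `[lo, hi]` and the integrand is interval
integrable on `[a, b]`. [cite: MahboubiMelquiondSibutpinote2016, Sect. 3.3] -/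
def FSegOK (f : ℝ → ℝ) (q : Poly) (S : ℕ) (a b : ℚ) (lo hi : ℤ) : Prop :=
  (lo : ℝ) ≤ S * ∫ t in (a : ℝ)..(b : ℝ), f t * Poly.eval q t ∧
    S * ∫ t in (a : ℝ)..(b : ℝ), f t * Poly.eval q t ≤ (hi : ℝ) ∧
      IntervalIntegrable (fun t => f t * Poly.eval q t) volume (a : ℝ) (b : ℝ)

/-- **A panel segment from a Taylor model**: if `W` encloses `u ↦ f(t_j + u)` on `|u| ≤ h` for a measurable `f` and the
kernel's panel enclosure `panelIntegI` lies inside `[plo, phi]`, then the segment over panel `j` is certified.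
[cite: MahboubiMelquiondSibutpinote2016, Sect. 3.2 Lemma 3] -/
theorem fsegOK_of_tmem {S : ℕ} (hS : 0 < S) {h : ℚ} (h0 : 0 < h) {f : ℝ → ℝ} (hf : Measurable f) (q : Poly)
    (j : ℕ) {W : IPoly} (hW : TMem S h (fun u => f ((panelCentre h j : ℝ) + u)) W) {plo phi : ℤ}
    (hlo : plo ≤ (panelIntegI S h W (midPoly S W) (recenter q h j)).lo)
    (hhi : (panelIntegI S h W (midPoly S W) (recenter q h j)).hi ≤ phi) :
    FSegOK f q S (panelLeft h j) (panelLeft h (j + 1)) plo phi := by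
  have hfi : IntervalIntegrable (fun u => f ((panelCentre h j : ℝ) + u)) volume (-(h : ℝ)) h :=
    intervalIntegrable_of_tmem hS h0.le hW (hf.comp (measurable_const.add measurable_id))
  have hm := mem_panelIntegI hS h0.le hW hfi (midPoly S W) (recenter q h j)
  have e1 : -(h : ℝ) + (panelCentre h j : ℝ) = ((panelLeft h j : ℚ) : ℝ) := by
    simp only [panelCentre, panelLeft]; push_cast; ring
  have e2 : (h : ℝ) + (panelCentre h j : ℝ) = ((panelLeft h (j + 1) : ℚ) : ℝ) := by
    simp only [panelCentre, panelLeft]; push_cast; ring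
  have hI : IntervalIntegrable (fun t => f t * Poly.eval q t) volume ((panelLeft h j : ℚ) : ℝ)
      ((panelLeft h (j + 1) : ℚ) : ℝ) := by
    have h1 := hfi.comp_sub_right ((panelCentre h j : ℝ))
    have e0 : (fun x => f ((panelCentre h j : ℝ) + (x - (panelCentre h j : ℝ)))) = f := by
      funext x; congr 1; ring
    rw [e0, e1, e2] at h1
    exact h1.mul_continuousOn (Poly.continuous_eval q).continuousOn
  have e : ∫ u in (-(h : ℝ))..h, f ((panelCentre h j : ℝ) + u) * Poly.eval (recenter q h j) u =
      ∫ t in ((panelLeft h j : ℚ) : ℝ)..((panelLeft h (j + 1) : ℚ) : ℝ), f t * Poly.eval q t := by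
    simp_rw [eval_recenter]
    have hs := intervalIntegral.integral_comp_add_left (fun t => f t * Poly.eval q t)
      ((panelCentre h j : ℝ)) (a := -(h : ℝ)) (b := h)
    rw [hs, ← e1, ← e2]
    congr 1 <;> ring
  rw [e] at hm
  obtain ⟨hm1, hm2⟩ := hm
  have hloR : ((plo : ℤ) : ℝ) ≤ ((panelIntegI S h W (midPoly S W) (recenter q h j)).lo : ℝ) := by
    exact_mod_cast hlo
  have hhiR : ((panelIntegI S h W (midPoly S W) (recenter q h j)).hi : ℝ) ≤ ((phi : ℤ) : ℝ) := by
    exact_mod_cast hhi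
  refine ⟨?_, ?_, hI⟩
  · rw [mul_comm]; exact hloR.trans hm1
  · rw [mul_comm]; exact hm2.trans hhiR

/-- **The per-panel certificate** for a program: positivity of `S` and `h`, the panel model accepted, and the
kernel's panel enclosure inside `[plo, phi]`. [folklore] -/
def panelCheckS (S : ℕ) (h : ℚ) (D K Ke ke Kl : ℕ) (p : SProg) (q : Poly) (j : ℕ) (cs : List (List ℤ × ℕ))
    (plo phi : ℤ) : Bool :=
  let r := p.pmodel S h D K Ke ke Kl (panelCentre h j) cs
  let I := panelIntegI S h r.1 (midPoly S r.1) (recenter q h j)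
  decide (0 < S) && decide (0 < h) && r.2 && decide (plo ≤ I.lo) && decide (I.hi ≤ phi)

/-- **Soundness of the per-panel certificate.** [cite: MahboubiMelquiondSibutpinote2016, Sect. 3.2 Lemma 3] -/
theorem fsegOK_of_panelCheckS {S : ℕ} {h : ℚ} {D K Ke ke Kl : ℕ} {p : SProg} {q : Poly} {j : ℕ}
    {cs : List (List ℤ × ℕ)} {plo phi : ℤ} (hc : panelCheckS S h D K Ke ke Kl p q j cs plo phi = true) :
    FSegOK p.toFun q S (panelLeft h j) (panelLeft h (j + 1)) plo phi := by
  unfold panelCheckS at hc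
  simp only [Bool.and_eq_true, decide_eq_true_eq] at hc
  obtain ⟨⟨⟨⟨hS, h0⟩, hok⟩, hlo⟩, hhi⟩ := hc
  exact fsegOK_of_tmem hS h0 (SProg.measurable_toFun p) q j
    (SProg.tmem_pmodel hS h0.le (panelCentre h j) p cs hok) hlo hhi

/-- **Gluing two adjacent segments.** [cite: MahboubiMelquiondSibutpinote2016, Sect. 3.3] -/
theorem FSegOK.append {f : ℝ → ℝ} {q : Poly} {S : ℕ} {a b c : ℚ} {lo₁ hi₁ lo₂ hi₂ : ℤ}
    (h₁ : FSegOK f q S a b lo₁ hi₁) (h₂ : FSegOK f q S b c lo₂ hi₂) :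
    FSegOK f q S a c (lo₁ + lo₂) (hi₁ + hi₂) := by
  obtain ⟨l1, u1, i1⟩ := h₁
  obtain ⟨l2, u2, i2⟩ := h₂
  refine ⟨?_, ?_, i1.trans i2⟩
  · rw [← intervalIntegral.integral_add_adjacent_intervals i1 i2, mul_add]; push_cast; linarith
  · rw [← intervalIntegral.integral_add_adjacent_intervals i1 i2, mul_add]; push_cast; linarith

/-- From a segment to bounds on the integral itself (`lo' · S ≤ lo`, `hi ≤ hi' · S`).
[cite: MahboubiMelquiondSibutpinote2016, Sect. 3.2 Lemma 3, Sect. 3.3] -/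
theorem FSegOK.bounds {f : ℝ → ℝ} {q : Poly} {S : ℕ} {a b : ℚ} {lo hi : ℤ} (hs : FSegOK f q S a b lo hi)
    (hS : 0 < S) {lo' hi' : ℚ} (hlo : lo' * S ≤ lo) (hhi : (hi : ℚ) ≤ hi' * S) :
    (lo' : ℝ) ≤ ∫ t in (a : ℝ)..(b : ℝ), f t * Poly.eval q t ∧
      ∫ t in (a : ℝ)..(b : ℝ), f t * Poly.eval q t ≤ (hi' : ℝ) := by
  obtain ⟨l, u, -⟩ := hs
  have hSr : (0 : ℝ) < S := by exact_mod_cast hS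
  have hloR : (lo' : ℝ) * S ≤ (lo : ℝ) := by exact_mod_cast hlo
  have hhiR : (hi : ℝ) ≤ (hi' : ℝ) * S := by exact_mod_cast hhi
  rw [mul_comm (S : ℝ)] at l u
  exact ⟨le_of_mul_le_mul_right (hloR.trans l) hSr, le_of_mul_le_mul_right (u.trans hhiR) hSr⟩

end PolyMP

end Literature.Analysis.ValidatedNumerics
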